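import Summits.QuantumFields.BalabanUV.T4Continuum.Support.ShellMeasurePlaquetteCubicLocatedDichEnd

/-!
# `T4Continuum.ShellMeasurePlaquetteCubicLocatedDichOut` — REPAIR of F-ne7cleaf02g9-1, part 5 (row S77 f6, the owner's
# SHAPE (1) «HONEST BOUNDARY», R-ne7cp1-g32-3): the pinned (P4) END with INPUT letters `Λ` (moving AND frozen exterior
# letters) and OUTPUT bonds an arbitrary family `incl : ι → Λ` (the MOVING bonds) — the star ∕ lowest-scale dichotomy
# asked ONLY at the output bonds; the FROZEN-BOUNDARY corollary with full stars of the moving bonds and the ORIGINAL constant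
(cell `pub-balaban`, sub-cell `t4`, spine estimate NE7c (node U5b); NE7c ROUND-2 crew, unit
`b2b-balaban-t4-ne7c-formalise-leaf-02` gen 9; owner table `t4/b2b-balaban-t4-ne7c-p1/LEAVES-NE7c-P1.md` row S77 f6;
FINDING F-ne7cleaf02g9-1 (journal l.18166, GAPS l.27205; owner RULING R-ne7cp1-g32-3 l.18202); ADDITIVE — imports part 3
`ShellMeasurePlaquetteCubicLocatedDichEnd` ONLY; [folklore]; one `instance` (output-weight positivity), 0 `def … : Prop`,
0 sorry, 0 citation tags)

HONEST FRAMING.  Finite four-torus programme, rung (B)+1 only — NOT infinite volume, NOT a mass gap, NOT the Clay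
problem, NOT summit progress; (B), `BetaPertHyp`, (B^μ) are not consumed.  NE7c (`T4IndicatorShell.ShellWeightBound`)
is NOT PRINTED in [Balaban 1983–89] and NOT PROVED; «NE7c ⇐ the named binders» (trigger c3, WALL
`t4/b2b-balaban-t4-ne7c-p1/WALL-NE7c-P1.md` §2b).  ELEMENTARY assembly for OUR typed action; [Balaban1985Variational]
(97)–(98) and [Balaban1987RG1] (2.16) LOCATE the shape only — the papers are under adjudication; nothing printed is
asserted or cited as a fact; no estimate of Bałaban's at a live level is discharged; the identification of `Λ`, `ι`,
the weights and the block with Bałaban's objects is node O's ([dict]).  HONEST DEPENDENCY (cell): continuum YM on T⁴ ⇐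
BetaPertH ∧ nine spine estimates (0/9 proved); BetaPertH ⇐ (D1) ∧ (D4) ∧ CAP+tail; G-an2-4 gates asym, D1 and NE2/3/4.

THE POINT (owner's condition (1) of R-ne7cp1-g32-3).  For the block `□^{∼4}` of a live slot the boundary bonds sit at
level `j`, not at the lowest scale; the honest typing keeps the FULL star of every MOVING bond and lets the plaquettes
that straddle the block carry FROZEN exterior letters.  In our currency: the plaquette letters range over a finite bond
set `Λ` (moving + frozen letters, `hbd` into `Λ`), the field space is `WMax` over `Λ` (the consumer freezes the exterior
coordinates by composing with extension by zero — a frozen unitary letter `V(b)e^{X_b}` is part of the background), and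
the gradient is READ ONLY AT THE MOVING BONDS, an arbitrary family `incl : ι → ↥Λ`.  Then «full star of every moving bond
in `Pl`» + «every letter of `Pl` in `Λ`» is CONSISTENT (the star's letters need only lie in `Λ`, not among the moving
bonds) — no translation closure, no vacuity.
* **`prop4Hyp_pinned_ord₃_eta_levels_dich_out`**: part 3's `_dich` with OUTPUT index `ι` (S75 f2 `prop4Hyp_pinned_weighted`
  has independent input∕output index types): the dichotomy `plaqStar (incl c) ⊆ Pl ∨ wt (incl c) ≤ L_b·η`, the floors,
  the scale jump and the ∇-datum domination asked ONLY at the output bonds `incl c`; row sums displayed;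
* `_dich_out_explicit` (file 4's count, `posOut` frozen at the bond), `_dich_out_geom` (leaf-03: `m := 4d`, stencil reach),
  `_dich_out_torusPin` (S69 torus pin, `R := 2`);
* **`prop4Hyp_pinned_ord₃_eta_levels_frozen_torusPin`** — THE OWNER'S SHAPE LITERALLY: `hst : ∀ c : ι, plaqStar (incl c) ⊆ Pl`
  (full stars of the MOVING bonds), NO lowest-scale clause (`L_b := 0`), stencil constant the ORIGINAL `72(d−1)‖τ‖Lc³`:
  `Prop4Hyp (W_pin^{out}) ((72(d−1)‖τ‖Lc³·((3d+2)d) + 8κLc⁴·16d)·e^{2δ′}) (ε∕2)`.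
NON-VACUITY (G-1): the sequel `…FrozenWitness` fires `_frozen_torusPin` on `ι` = the four bonds of `p₀`, `Pl` = the five
plaquettes of their stars, `Λ` = the `[-1,2]²` box of letters.  Nothing in the countdown moves; NE7c NOT PROVED; spine
PROVED 0∕9.
-/

noncomputable section

open scoped BigOperators

namespace Summit.QuantumFields.BalabanUV.T4Continuum.ShellMeasurePlaquetteCubicLocatedDichOut

open Literature.MathematicalPhysics.QuantumFieldTheory.Balaban1983to89
open B7Prop1Explicit (e U1 mem_U1)
open B8Ineq132 (covDerivFwd)
open B11Prop6Scheme (Prop4Hyp)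
open B12Decay510Torus (pl1)
open TreeLengthTorus (TPt proj)
open ShellMeasureWilsonGradientTail (plaqWord bonds)
open ShellMeasurePlaquetteTwist (plaqFunSym)
open ShellMeasureLocalGradientTailJet (ord₃)
open Summit.QuantumFields.BalabanUV.T4Continuum.ShellMeasureCommutatorVariation (plaqStar)
open Summit.QuantumFields.BalabanUV.T4Continuum.ShellMeasureCommutatorGradientLocal (baseSites nbhdSites)
open Summit.QuantumFields.BalabanUV.T4Continuum.ShellMeasureCommutatorLocGrad (ext)
open Summit.QuantumFields.BalabanUV.T4Continuum.ShellMeasureLocalGradientTail (locGrad)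
open Summit.QuantumFields.BalabanUV.T4Continuum.ShellMeasureMultiGridNorms (WSup)
open Summit.QuantumFields.BalabanUV.T4Continuum.ShellMeasureMultiGridNormsMax (WMax)
open Summit.QuantumFields.BalabanUV.T4Continuum.ShellMeasurePinnedNorm (pinW pinDist pinDist_nonneg pinDist_le_add)
open Summit.QuantumFields.BalabanUV.T4Continuum.ShellMeasurePinnedProp4Weighted (prop4Hyp_pinned_weighted)
open Summit.QuantumFields.BalabanUV.T4Continuum.ShellMeasureWilsonRemainderLevels (etaScale)
open Summit.QuantumFields.BalabanUV.T4Continuum.ShellMeasurePlaquetteCubicLocatedPinnedLevels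
  (differentiable_locGrad_etaScale_sum_ord₃)
open Summit.QuantumFields.BalabanUV.T4Continuum.ShellMeasurePlaquetteCubicLocatedRowSum (rowSum_kernel_le)
open Summit.QuantumFields.BalabanUV.T4Continuum.ShellMeasurePlaquetteCubicLocatedStencil
  (mem_nbhdSites_of_mem_bonds card_filter_mem_bonds_le reach_torusPin_le_two)
open Summit.QuantumFields.BalabanUV.T4Continuum.ShellMeasurePlaquetteCubicLocatedDich (located_quad_ord₃_eta_levels_dich_kernel)

export B7Prop1Explicit (Site)

variable {d : ℕ} {𝔸 : Type*} [NormedRing 𝔸] [NormOneClass 𝔸] [NormedAlgebra ℂ 𝔸] [CompleteSpace 𝔸]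
  (Λ : Finset (Site d × Fin d)) (Pl : Finset (Fin d × Fin d × Site d)) (τ : 𝔸 →L[ℂ] ℂ)
  {U₀ : Site d → Fin d → 𝔸ˣ} (h₀ : ∀ y κ, U₀ y κ ∈ U1 𝔸) (bd : Fin d × Fin d × Site d → (Fin 4 → ↥Λ × Bool))
  (wt : ↥Λ → ℝ) [hwt : Fact (∀ b, 0 < wt b)] {I : Type*} [Fintype I] (wd : I → ℝ) [hwd : Fact (∀ i, 0 < wd i)]
  (Dv : (↥Λ → 𝔸) →L[ℂ] (I → 𝔸)) (Wf Wd : ↥Λ → ℝ) (W : Fin d × Fin d × Site d → ℝ)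
  {ι : Type*} [Fintype ι] (incl : ι → ↥Λ)

/-- The output weight `(wt (incl c))³` (the `|·|_{(−3)}` reading at the moving bonds) is positive. [folklore] -/
instance instFactPowThreeIncl : Fact (∀ c : ι, 0 < wt (incl c) ^ 3) := ⟨fun c => pow_pos (hwt.out (incl c)) 3⟩

include h₀

omit [Fintype ι] in
/-- THE GRADIENT READ AT THE OUTPUT BONDS is differentiable (part 3's entire gradient composed with evaluation at
`incl c`, coordinate by coordinate). [folklore] -/
theorem differentiable_locGrad_out (η : ℝ) :
    Differentiable ℂ fun Y : WMax wt wd Dv => fun c : ι =>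
      locGrad (etaScale η (fun A : ↥Λ → 𝔸 =>
        ∑ p ∈ Pl, ord₃ (plaqFunSym τ (fun b : ↥Λ => U₀ b.1.1 b.1.2) (bd p)) A)) (WMax.toPiL wt wd Dv Y) (incl c) :=
  differentiable_pi.2 fun c =>
    differentiable_pi.1 (differentiable_locGrad_etaScale_sum_ord₃ Λ Pl τ h₀ bd wt wd Dv η) (incl c)

/-- **THE PINNED (P4) BINDER AT THE LIVE LEVELS, OUTPUT AT THE MOVING BONDS (row sums displayed).**  INPUT: fields on
ALL letters `Λ` (`WMax (wt·e^{δ′ϖ∘posIn}) wd Dv`); OUTPUT: the pinned weighted gradient at the bonds `incl c`, `c : ι`.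
Hypotheses: part 3's, except that the dichotomy `plaqStar (incl c) ⊆ Pl ∨ wt (incl c) ≤ L_b·η`, the floors `Wf`∕`Wd`,
the scale jump and the ∇-datum domination are asked ONLY at the output bonds; the plaquette data (`bd p = ∂p` in `Λ`
oriented `(+,+,−,−)`, `Pl` increasing, weights `W p ≤ wt b ≤ Lc·W p` on `∂p`, `η ≤ W p`, `‖U₀(∂p) − 1‖ ≤ ε₀(η∕W p)²`)
for every `p ∈ Pl`; pin `ρ`, `posIn : ↥Λ → S`, `posOut : ι → S`, `ϖ ≥ 0` one-sided Lipschitz, `δ′ ≥ 0`; row sums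
`∀ c, Σ_b k (incl c) b·e^{δ′ρ(posOut c, posIn b)} ≤ M` with
`k c′ b = K∇·[b.1.1 ∈ nbhdSites c′] + 8κLc⁴·#{p ∈ Pl : c′, b ∈ ∂p}`, `K∇ = (d−1)‖τ‖(72Lc³ + 48L_b·Lc²·((3d+2)d))`.
Conclusion: `Prop4Hyp (W_pin^{out}) M (ε∕2)` — S75 f2 `prop4Hyp_pinned_weighted` FIRED with output index `ι`.
[Balaban1985Variational] (98) TYPE, located and pinned; nothing printed is asserted. [folklore] -/
theorem prop4Hyp_pinned_ord₃_eta_levels_dich_out {η : ℝ} (hη : 0 < η) (htr : ∀ P Q : 𝔸, τ (P * Q) = τ (Q * P))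
    (hincr : ∀ p ∈ Pl, p.1 < p.2.1) {Lc Lb : ℝ} (hLc : 1 ≤ Lc) (hLb : 0 ≤ Lb)
    (hdich : ∀ c : ι, plaqStar (incl c).1.1 (incl c).1.2 ⊆ Pl ∨ wt (incl c) ≤ Lb * η)
    (hbd : ∀ p ∈ Pl, ((bd p 0).1 : Site d × Fin d) = (p.2.2, p.1) ∧ ((bd p 1).1 : Site d × Fin d) = (p.2.2 + e p.1, p.2.1)
      ∧ ((bd p 2).1 : Site d × Fin d) = (p.2.2 + e p.2.1, p.1) ∧ ((bd p 3).1 : Site d × Fin d) = (p.2.2, p.2.1))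
    (hor : ∀ p ∈ Pl, (bd p 0).2 = true ∧ (bd p 1).2 = true ∧ (bd p 2).2 = false ∧ (bd p 3).2 = false)
    (hWd0 : ∀ c : ι, 0 < Wd (incl c))
    (hWf : ∀ (c : ι) (b' : ↥Λ), b'.1.1 ∈ nbhdSites (incl c).1.1 (incl c).1.2 → Wf (incl c) ≤ wt b')
    (hcf : ∀ c : ι, wt (incl c) ≤ Lc * Wf (incl c)) (hcd : ∀ c : ι, wt (incl c) ≤ Lc * Wd (incl c))
    (hDv : ∀ (A : ↥Λ → 𝔸) (c : ι) (x : Site d) (κ' τ' : Fin d), x ∈ baseSites (incl c).1.1 →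
      Wd (incl c) ^ 2 * ‖covDerivFwd η U₀ κ' (fun z => ext Λ A z τ') x‖ ≤ ‖(WSup.toPiL wd 2).symm (Dv A)‖)
    {ε ε₀ : ℝ} (hε : 0 < ε) (hε₀ : 0 ≤ ε₀) (hε4 : 4 * ε ≤ 1) (hηW : ∀ p ∈ Pl, η ≤ W p)
    (hWw : ∀ p ∈ Pl, ∀ b ∈ bonds (bd p), W p ≤ wt b) (hwW : ∀ p ∈ Pl, ∀ b ∈ bonds (bd p), wt b ≤ Lc * W p)
    (hreg : ∀ p ∈ Pl, ‖(plaqWord (fun b : ↥Λ => U₀ b.1.1 b.1.2) (bd p) (0 : ↥Λ → 𝔸) : 𝔸) - 1‖ ≤ ε₀ * (η / W p) ^ 2)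
    {S : Type*} (ρ : S → S → ℝ) (posIn : ↥Λ → S) (posOut : ι → S) (ϖ : S → ℝ) {δ' M : ℝ} (hδ' : 0 ≤ δ')
    (hϖ0 : ∀ x, 0 ≤ ϖ x) (hϖ : ∀ x y, ϖ x ≤ ϖ y + ρ x y) (hM0 : 0 ≤ M)
    (hM : ∀ c : ι, ∑ b : ↥Λ,
      (((d : ℝ) - 1) * ‖τ‖ * (72 * Lc ^ 3 + 48 * Lb * Lc ^ 2 * ((3 * d + 2) * d : ℕ)) *
          (if b.1.1 ∈ nbhdSites (incl c).1.1 (incl c).1.2 then 1 else 0)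
        + 8 * (‖τ‖ * (248 / 3 * ε₀ + 40 / 3 * ε)) * Lc ^ 4 *
          ((Pl.filter (fun p => incl c ∈ bonds (bd p) ∧ b ∈ bonds (bd p))).card : ℝ))
        * Real.exp (δ' * ρ (posOut c) (posIn b)) ≤ M) :
    Prop4Hyp (fun Y : WMax (fun b => wt b * pinW δ' (ϖ ∘ posIn) b) wd Dv =>
        ((WSup.toPiL (fun c : ι => wt (incl c) ^ 3 * pinW δ' (ϖ ∘ posOut) c) 1).symm
          (fun c : ι => locGrad (etaScale η (fun A : ↥Λ → 𝔸 =>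
              ∑ p ∈ Pl, ord₃ (plaqFunSym τ (fun b : ↥Λ => U₀ b.1.1 b.1.2) (bd p)) A))
            (WMax.toPiL (fun b => wt b * pinW δ' (ϖ ∘ posIn) b) wd Dv Y) (incl c)) :
          WSup (fun c : ι => wt (incl c) ^ 3 * pinW δ' (ϖ ∘ posOut) c) 1 (𝔸 →L[ℂ] ℂ))) M (ε / 2) := by
  refine prop4Hyp_pinned_weighted wt wd Dv (fun c : ι => wt (incl c) ^ 3)
    (fun (A : ↥Λ → 𝔸) (c : ι) => locGrad (etaScale η (fun A : ↥Λ → 𝔸 =>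
      ∑ p ∈ Pl, ord₃ (plaqFunSym τ (fun b : ↥Λ => U₀ b.1.1 b.1.2) (bd p)) A)) A (incl c))
    _ ρ posIn posOut ϖ hδ' hϖ0 hϖ (fun c b => ?_)
    (fun Y hY c => located_quad_ord₃_eta_levels_dich_kernel Λ Pl τ h₀ bd wt wd Dv Wf Wd W hη htr hincr hLc hLb (hdich c)
      hbd hor (hWd0 c) (hWf c) (hcf c) (hcd c) (fun A x κ' τ' hx => hDv A c x κ' τ' hx) hε hε₀ hε4 hηW hWw hwW hreg Y hY)
    hM0 hM ((differentiable_locGrad_out Λ Pl τ h₀ bd wt wd Dv incl η).differentiableOn)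
  -- the kernel is nonnegative
  have hd : 0 ≤ (d : ℝ) - 1 := by
    have : 1 ≤ d := Nat.succ_le_of_lt (Fin.pos (incl c).1.2)
    have : (1 : ℝ) ≤ d := by exact_mod_cast this
    linarith
  have hLc0 : 0 ≤ Lc := zero_le_one.trans hLc
  have h1 : 0 ≤ (if b.1.1 ∈ nbhdSites (incl c).1.1 (incl c).1.2 then (1 : ℝ) else 0) := by split_ifs <;> norm_num
  positivity

/-- **OUTPUT VERSION, ROW SUM EXPLICIT** (file 4's count at the output bond; incidence `≤ m`; pin hypothesis
«kernel-neighbours of `incl c` within pin-distance `R` of `posOut c`»; `1 ≤ d`):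
`M := (K∇·((3d+2)d) + 8κLc⁴·(4m))·e^{δ′R}`. [folklore] -/
theorem prop4Hyp_pinned_ord₃_eta_levels_dich_out_explicit {η : ℝ} (hη : 0 < η)
    (htr : ∀ P Q : 𝔸, τ (P * Q) = τ (Q * P)) (hincr : ∀ p ∈ Pl, p.1 < p.2.1) {Lc Lb : ℝ} (hLc : 1 ≤ Lc) (hLb : 0 ≤ Lb)
    (hdich : ∀ c : ι, plaqStar (incl c).1.1 (incl c).1.2 ⊆ Pl ∨ wt (incl c) ≤ Lb * η)
    (hbd : ∀ p ∈ Pl, ((bd p 0).1 : Site d × Fin d) = (p.2.2, p.1) ∧ ((bd p 1).1 : Site d × Fin d) = (p.2.2 + e p.1, p.2.1)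
      ∧ ((bd p 2).1 : Site d × Fin d) = (p.2.2 + e p.2.1, p.1) ∧ ((bd p 3).1 : Site d × Fin d) = (p.2.2, p.2.1))
    (hor : ∀ p ∈ Pl, (bd p 0).2 = true ∧ (bd p 1).2 = true ∧ (bd p 2).2 = false ∧ (bd p 3).2 = false)
    (hWd0 : ∀ c : ι, 0 < Wd (incl c))
    (hWf : ∀ (c : ι) (b' : ↥Λ), b'.1.1 ∈ nbhdSites (incl c).1.1 (incl c).1.2 → Wf (incl c) ≤ wt b')
    (hcf : ∀ c : ι, wt (incl c) ≤ Lc * Wf (incl c)) (hcd : ∀ c : ι, wt (incl c) ≤ Lc * Wd (incl c))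
    (hDv : ∀ (A : ↥Λ → 𝔸) (c : ι) (x : Site d) (κ' τ' : Fin d), x ∈ baseSites (incl c).1.1 →
      Wd (incl c) ^ 2 * ‖covDerivFwd η U₀ κ' (fun z => ext Λ A z τ') x‖ ≤ ‖(WSup.toPiL wd 2).symm (Dv A)‖)
    {ε ε₀ : ℝ} (hε : 0 < ε) (hε₀ : 0 ≤ ε₀) (hε4 : 4 * ε ≤ 1) (hηW : ∀ p ∈ Pl, η ≤ W p)
    (hWw : ∀ p ∈ Pl, ∀ b ∈ bonds (bd p), W p ≤ wt b) (hwW : ∀ p ∈ Pl, ∀ b ∈ bonds (bd p), wt b ≤ Lc * W p)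
    (hreg : ∀ p ∈ Pl, ‖(plaqWord (fun b : ↥Λ => U₀ b.1.1 b.1.2) (bd p) (0 : ↥Λ → 𝔸) : 𝔸) - 1‖ ≤ ε₀ * (η / W p) ^ 2)
    {m : ℕ} (hm : ∀ b : ↥Λ, (Pl.filter (fun p => b ∈ bonds (bd p))).card ≤ m) (hd1 : 1 ≤ d)
    {S : Type*} (ρ : S → S → ℝ) (posIn : ↥Λ → S) (posOut : ι → S) (ϖ : S → ℝ) {δ' R : ℝ} (hδ' : 0 ≤ δ')
    (hϖ0 : ∀ x, 0 ≤ ϖ x) (hϖ : ∀ x y, ϖ x ≤ ϖ y + ρ x y)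
    (hR : ∀ (c : ι) (b : ↥Λ), (b.1.1 ∈ nbhdSites (incl c).1.1 (incl c).1.2 ∨
      ∃ p ∈ Pl, incl c ∈ bonds (bd p) ∧ b ∈ bonds (bd p)) → ρ (posOut c) (posIn b) ≤ R) :
    Prop4Hyp (fun Y : WMax (fun b => wt b * pinW δ' (ϖ ∘ posIn) b) wd Dv =>
        ((WSup.toPiL (fun c : ι => wt (incl c) ^ 3 * pinW δ' (ϖ ∘ posOut) c) 1).symm
          (fun c : ι => locGrad (etaScale η (fun A : ↥Λ → 𝔸 =>
              ∑ p ∈ Pl, ord₃ (plaqFunSym τ (fun b : ↥Λ => U₀ b.1.1 b.1.2) (bd p)) A))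
            (WMax.toPiL (fun b => wt b * pinW δ' (ϖ ∘ posIn) b) wd Dv Y) (incl c)) :
          WSup (fun c : ι => wt (incl c) ^ 3 * pinW δ' (ϖ ∘ posOut) c) 1 (𝔸 →L[ℂ] ℂ)))
      ((((d : ℝ) - 1) * ‖τ‖ * (72 * Lc ^ 3 + 48 * Lb * Lc ^ 2 * ((3 * d + 2) * d : ℕ)) * ((3 * d + 2) * d : ℕ)
          + 8 * (‖τ‖ * (248 / 3 * ε₀ + 40 / 3 * ε)) * Lc ^ 4 * (4 * m)) * Real.exp (δ' * R))
      (ε / 2) := by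
  have hd : 0 ≤ (d : ℝ) - 1 := by
    have : (1 : ℝ) ≤ d := by exact_mod_cast hd1
    linarith
  have hLc0 : 0 ≤ Lc := zero_le_one.trans hLc
  have hK₁ : 0 ≤ ((d : ℝ) - 1) * ‖τ‖ * (72 * Lc ^ 3 + 48 * Lb * Lc ^ 2 * ((3 * d + 2) * d : ℕ)) := by positivity
  have hK₂ : 0 ≤ 8 * (‖τ‖ * (248 / 3 * ε₀ + 40 / 3 * ε)) * Lc ^ 4 := by positivity
  have hM0 : 0 ≤ (((d : ℝ) - 1) * ‖τ‖ * (72 * Lc ^ 3 + 48 * Lb * Lc ^ 2 * ((3 * d + 2) * d : ℕ)) * ((3 * d + 2) * d : ℕ)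
      + 8 * (‖τ‖ * (248 / 3 * ε₀ + 40 / 3 * ε)) * Lc ^ 4 * (4 * m)) * Real.exp (δ' * R) := by positivity
  refine prop4Hyp_pinned_ord₃_eta_levels_dich_out Λ Pl τ h₀ bd wt wd Dv Wf Wd W incl hη htr hincr hLc hLb hdich hbd hor
    hWd0 hWf hcf hcd hDv hε hε₀ hε4 hηW hWw hwW hreg ρ posIn posOut ϖ hδ' hϖ0 hϖ hM0 fun c => ?_
  -- file 4's row-sum count at the bond `incl c`, with the output position frozen at `posOut c`
  exact rowSum_kernel_le Λ Pl bd ρ posIn (fun _ : ↥Λ => posOut c) hδ' hK₁ hK₂ hm (incl c) (hR c)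

/-- **OUTPUT VERSION, GEOMETRIC** (leaf-03: `m := 4d` and the pin hypothesis from the STENCIL-ONLY reach at the output
bonds `hreach : b.1.1 ∈ nbhdSites (incl c) → ρ (posOut c) (posIn b) ≤ R`). [folklore] -/
theorem prop4Hyp_pinned_ord₃_eta_levels_dich_out_geom {η : ℝ} (hη : 0 < η)
    (htr : ∀ P Q : 𝔸, τ (P * Q) = τ (Q * P)) (hincr : ∀ p ∈ Pl, p.1 < p.2.1) {Lc Lb : ℝ} (hLc : 1 ≤ Lc) (hLb : 0 ≤ Lb)
    (hdich : ∀ c : ι, plaqStar (incl c).1.1 (incl c).1.2 ⊆ Pl ∨ wt (incl c) ≤ Lb * η)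
    (hbd : ∀ p ∈ Pl, ((bd p 0).1 : Site d × Fin d) = (p.2.2, p.1) ∧ ((bd p 1).1 : Site d × Fin d) = (p.2.2 + e p.1, p.2.1)
      ∧ ((bd p 2).1 : Site d × Fin d) = (p.2.2 + e p.2.1, p.1) ∧ ((bd p 3).1 : Site d × Fin d) = (p.2.2, p.2.1))
    (hor : ∀ p ∈ Pl, (bd p 0).2 = true ∧ (bd p 1).2 = true ∧ (bd p 2).2 = false ∧ (bd p 3).2 = false)
    (hWd0 : ∀ c : ι, 0 < Wd (incl c))
    (hWf : ∀ (c : ι) (b' : ↥Λ), b'.1.1 ∈ nbhdSites (incl c).1.1 (incl c).1.2 → Wf (incl c) ≤ wt b')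
    (hcf : ∀ c : ι, wt (incl c) ≤ Lc * Wf (incl c)) (hcd : ∀ c : ι, wt (incl c) ≤ Lc * Wd (incl c))
    (hDv : ∀ (A : ↥Λ → 𝔸) (c : ι) (x : Site d) (κ' τ' : Fin d), x ∈ baseSites (incl c).1.1 →
      Wd (incl c) ^ 2 * ‖covDerivFwd η U₀ κ' (fun z => ext Λ A z τ') x‖ ≤ ‖(WSup.toPiL wd 2).symm (Dv A)‖)
    {ε ε₀ : ℝ} (hε : 0 < ε) (hε₀ : 0 ≤ ε₀) (hε4 : 4 * ε ≤ 1) (hηW : ∀ p ∈ Pl, η ≤ W p)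
    (hWw : ∀ p ∈ Pl, ∀ b ∈ bonds (bd p), W p ≤ wt b) (hwW : ∀ p ∈ Pl, ∀ b ∈ bonds (bd p), wt b ≤ Lc * W p)
    (hreg : ∀ p ∈ Pl, ‖(plaqWord (fun b : ↥Λ => U₀ b.1.1 b.1.2) (bd p) (0 : ↥Λ → 𝔸) : 𝔸) - 1‖ ≤ ε₀ * (η / W p) ^ 2)
    (hd1 : 1 ≤ d) {S : Type*} (ρ : S → S → ℝ) (posIn : ↥Λ → S) (posOut : ι → S) (ϖ : S → ℝ) {δ' R : ℝ}
    (hδ' : 0 ≤ δ') (hϖ0 : ∀ x, 0 ≤ ϖ x) (hϖ : ∀ x y, ϖ x ≤ ϖ y + ρ x y)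
    (hreach : ∀ (c : ι) (b : ↥Λ), b.1.1 ∈ nbhdSites (incl c).1.1 (incl c).1.2 → ρ (posOut c) (posIn b) ≤ R) :
    Prop4Hyp (fun Y : WMax (fun b => wt b * pinW δ' (ϖ ∘ posIn) b) wd Dv =>
        ((WSup.toPiL (fun c : ι => wt (incl c) ^ 3 * pinW δ' (ϖ ∘ posOut) c) 1).symm
          (fun c : ι => locGrad (etaScale η (fun A : ↥Λ → 𝔸 =>
              ∑ p ∈ Pl, ord₃ (plaqFunSym τ (fun b : ↥Λ => U₀ b.1.1 b.1.2) (bd p)) A))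
            (WMax.toPiL (fun b => wt b * pinW δ' (ϖ ∘ posIn) b) wd Dv Y) (incl c)) :
          WSup (fun c : ι => wt (incl c) ^ 3 * pinW δ' (ϖ ∘ posOut) c) 1 (𝔸 →L[ℂ] ℂ)))
      ((((d : ℝ) - 1) * ‖τ‖ * (72 * Lc ^ 3 + 48 * Lb * Lc ^ 2 * ((3 * d + 2) * d : ℕ)) * ((3 * d + 2) * d : ℕ)
          + 8 * (‖τ‖ * (248 / 3 * ε₀ + 40 / 3 * ε)) * Lc ^ 4 * (4 * (4 * d : ℕ))) * Real.exp (δ' * R))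
      (ε / 2) := by
  refine prop4Hyp_pinned_ord₃_eta_levels_dich_out_explicit Λ Pl τ h₀ bd wt wd Dv Wf Wd W incl hη htr hincr hLc hLb hdich
    hbd hor hWd0 hWf hcf hcd hDv hε hε₀ hε4 hηW hWw hwW hreg (card_filter_mem_bonds_le Pl hbd) hd1 ρ posIn posOut ϖ hδ'
    hϖ0 hϖ fun c b hb => ?_
  rcases hb with hb | ⟨p, hp, hc, hb⟩
  · exact hreach c b hb
  · exact hreach c b (mem_nbhdSites_of_mem_bonds (hbd p hp) hc hb)

/-- **OUTPUT VERSION, THE CONCRETE TORUS PIN** (S69's `pinDist B₀ hB₀`, positions `proj T ·.1.1` of the letters resp.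
of the output bonds, periodic ℓ¹ distance, rate `δ′ ≥ 0`, reach `2`; no displayed pin datum left). [folklore] -/
theorem prop4Hyp_pinned_ord₃_eta_levels_dich_out_torusPin {η : ℝ} (hη : 0 < η)
    (htr : ∀ P Q : 𝔸, τ (P * Q) = τ (Q * P)) (hincr : ∀ p ∈ Pl, p.1 < p.2.1) {Lc Lb : ℝ} (hLc : 1 ≤ Lc) (hLb : 0 ≤ Lb)
    (hdich : ∀ c : ι, plaqStar (incl c).1.1 (incl c).1.2 ⊆ Pl ∨ wt (incl c) ≤ Lb * η)
    (hbd : ∀ p ∈ Pl, ((bd p 0).1 : Site d × Fin d) = (p.2.2, p.1) ∧ ((bd p 1).1 : Site d × Fin d) = (p.2.2 + e p.1, p.2.1)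
      ∧ ((bd p 2).1 : Site d × Fin d) = (p.2.2 + e p.2.1, p.1) ∧ ((bd p 3).1 : Site d × Fin d) = (p.2.2, p.2.1))
    (hor : ∀ p ∈ Pl, (bd p 0).2 = true ∧ (bd p 1).2 = true ∧ (bd p 2).2 = false ∧ (bd p 3).2 = false)
    (hWd0 : ∀ c : ι, 0 < Wd (incl c))
    (hWf : ∀ (c : ι) (b' : ↥Λ), b'.1.1 ∈ nbhdSites (incl c).1.1 (incl c).1.2 → Wf (incl c) ≤ wt b')
    (hcf : ∀ c : ι, wt (incl c) ≤ Lc * Wf (incl c)) (hcd : ∀ c : ι, wt (incl c) ≤ Lc * Wd (incl c))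
    (hDv : ∀ (A : ↥Λ → 𝔸) (c : ι) (x : Site d) (κ' τ' : Fin d), x ∈ baseSites (incl c).1.1 →
      Wd (incl c) ^ 2 * ‖covDerivFwd η U₀ κ' (fun z => ext Λ A z τ') x‖ ≤ ‖(WSup.toPiL wd 2).symm (Dv A)‖)
    {ε ε₀ : ℝ} (hε : 0 < ε) (hε₀ : 0 ≤ ε₀) (hε4 : 4 * ε ≤ 1) (hηW : ∀ p ∈ Pl, η ≤ W p)
    (hWw : ∀ p ∈ Pl, ∀ b ∈ bonds (bd p), W p ≤ wt b) (hwW : ∀ p ∈ Pl, ∀ b ∈ bonds (bd p), wt b ≤ Lc * W p)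
    (hreg : ∀ p ∈ Pl, ‖(plaqWord (fun b : ↥Λ => U₀ b.1.1 b.1.2) (bd p) (0 : ↥Λ → 𝔸) : 𝔸) - 1‖ ≤ ε₀ * (η / W p) ^ 2)
    (hd1 : 1 ≤ d) {T : ℕ} [NeZero T] (B₀ : Finset (TPt d T)) (hB₀ : B₀.Nonempty) {δ' : ℝ} (hδ' : 0 ≤ δ') :
    Prop4Hyp (fun Y : WMax (fun b => wt b * pinW δ' (pinDist B₀ hB₀ ∘ fun b : ↥Λ => proj T b.1.1) b) wd Dv =>
        ((WSup.toPiL (fun c : ι => wt (incl c) ^ 3 *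
            pinW δ' (pinDist B₀ hB₀ ∘ fun c : ι => proj T (incl c).1.1) c) 1).symm
          (fun c : ι => locGrad (etaScale η (fun A : ↥Λ → 𝔸 =>
              ∑ p ∈ Pl, ord₃ (plaqFunSym τ (fun b : ↥Λ => U₀ b.1.1 b.1.2) (bd p)) A))
            (WMax.toPiL (fun b => wt b * pinW δ' (pinDist B₀ hB₀ ∘ fun b : ↥Λ => proj T b.1.1) b) wd Dv Y) (incl c)) :
          WSup (fun c : ι => wt (incl c) ^ 3 * pinW δ' (pinDist B₀ hB₀ ∘ fun c : ι => proj T (incl c).1.1) c) 1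
            (𝔸 →L[ℂ] ℂ)))
      ((((d : ℝ) - 1) * ‖τ‖ * (72 * Lc ^ 3 + 48 * Lb * Lc ^ 2 * ((3 * d + 2) * d : ℕ)) * ((3 * d + 2) * d : ℕ)
          + 8 * (‖τ‖ * (248 / 3 * ε₀ + 40 / 3 * ε)) * Lc ^ 4 * (4 * (4 * d : ℕ))) * Real.exp (δ' * 2))
      (ε / 2) :=
  prop4Hyp_pinned_ord₃_eta_levels_dich_out_geom Λ Pl τ h₀ bd wt wd Dv Wf Wd W incl hη htr hincr hLc hLb hdich hbd hor hWd0
    hWf hcf hcd hDv hε hε₀ hε4 hηW hWw hwW hreg hd1 (fun x y : TPt d T => pl1 (x - y)) (fun b : ↥Λ => proj T b.1.1)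
    (fun c : ι => proj T (incl c).1.1) (pinDist B₀ hB₀) hδ' (pinDist_nonneg B₀ hB₀) (pinDist_le_add B₀ hB₀)
    (fun c b hb => reach_torusPin_le_two T (incl c) b hb)

/-- **THE OWNER'S SHAPE (1) LITERALLY — FULL STARS OF THE MOVING BONDS, FROZEN EXTERIOR LETTERS, ORIGINAL CONSTANT.**
With `Pl` ⊇ the plaquette star of every MOVING bond `incl c` (all their letters in `Λ`, the exterior ones frozen by the
consumer) there is NO lowest-scale clause: the torus-pin END with `L_b := 0`, stencil constant `72(d−1)‖τ‖Lc³` —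
`Prop4Hyp (W_pin^{out}) ((72(d−1)‖τ‖Lc³·((3d+2)d) + 8κLc⁴·16d)·e^{2δ′}) (ε∕2)`.  This is the (P4) binder of
END-II∕S70 f4∕S76∕S80 for OUR action at a live slot in the honest-boundary typing ([Balaban1987RG1] (2.16) TYPE block,
frozen exterior; nothing printed is asserted). [folklore] -/
theorem prop4Hyp_pinned_ord₃_eta_levels_frozen_torusPin {η : ℝ} (hη : 0 < η)
    (htr : ∀ P Q : 𝔸, τ (P * Q) = τ (Q * P)) (hincr : ∀ p ∈ Pl, p.1 < p.2.1) {Lc : ℝ} (hLc : 1 ≤ Lc)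
    (hst : ∀ c : ι, plaqStar (incl c).1.1 (incl c).1.2 ⊆ Pl)
    (hbd : ∀ p ∈ Pl, ((bd p 0).1 : Site d × Fin d) = (p.2.2, p.1) ∧ ((bd p 1).1 : Site d × Fin d) = (p.2.2 + e p.1, p.2.1)
      ∧ ((bd p 2).1 : Site d × Fin d) = (p.2.2 + e p.2.1, p.1) ∧ ((bd p 3).1 : Site d × Fin d) = (p.2.2, p.2.1))
    (hor : ∀ p ∈ Pl, (bd p 0).2 = true ∧ (bd p 1).2 = true ∧ (bd p 2).2 = false ∧ (bd p 3).2 = false)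
    (hWd0 : ∀ c : ι, 0 < Wd (incl c))
    (hWf : ∀ (c : ι) (b' : ↥Λ), b'.1.1 ∈ nbhdSites (incl c).1.1 (incl c).1.2 → Wf (incl c) ≤ wt b')
    (hcf : ∀ c : ι, wt (incl c) ≤ Lc * Wf (incl c)) (hcd : ∀ c : ι, wt (incl c) ≤ Lc * Wd (incl c))
    (hDv : ∀ (A : ↥Λ → 𝔸) (c : ι) (x : Site d) (κ' τ' : Fin d), x ∈ baseSites (incl c).1.1 →
      Wd (incl c) ^ 2 * ‖covDerivFwd η U₀ κ' (fun z => ext Λ A z τ') x‖ ≤ ‖(WSup.toPiL wd 2).symm (Dv A)‖)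
    {ε ε₀ : ℝ} (hε : 0 < ε) (hε₀ : 0 ≤ ε₀) (hε4 : 4 * ε ≤ 1) (hηW : ∀ p ∈ Pl, η ≤ W p)
    (hWw : ∀ p ∈ Pl, ∀ b ∈ bonds (bd p), W p ≤ wt b) (hwW : ∀ p ∈ Pl, ∀ b ∈ bonds (bd p), wt b ≤ Lc * W p)
    (hreg : ∀ p ∈ Pl, ‖(plaqWord (fun b : ↥Λ => U₀ b.1.1 b.1.2) (bd p) (0 : ↥Λ → 𝔸) : 𝔸) - 1‖ ≤ ε₀ * (η / W p) ^ 2)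
    (hd1 : 1 ≤ d) {T : ℕ} [NeZero T] (B₀ : Finset (TPt d T)) (hB₀ : B₀.Nonempty) {δ' : ℝ} (hδ' : 0 ≤ δ') :
    Prop4Hyp (fun Y : WMax (fun b => wt b * pinW δ' (pinDist B₀ hB₀ ∘ fun b : ↥Λ => proj T b.1.1) b) wd Dv =>
        ((WSup.toPiL (fun c : ι => wt (incl c) ^ 3 *
            pinW δ' (pinDist B₀ hB₀ ∘ fun c : ι => proj T (incl c).1.1) c) 1).symm
          (fun c : ι => locGrad (etaScale η (fun A : ↥Λ → 𝔸 =>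
              ∑ p ∈ Pl, ord₃ (plaqFunSym τ (fun b : ↥Λ => U₀ b.1.1 b.1.2) (bd p)) A))
            (WMax.toPiL (fun b => wt b * pinW δ' (pinDist B₀ hB₀ ∘ fun b : ↥Λ => proj T b.1.1) b) wd Dv Y) (incl c)) :
          WSup (fun c : ι => wt (incl c) ^ 3 * pinW δ' (pinDist B₀ hB₀ ∘ fun c : ι => proj T (incl c).1.1) c) 1
            (𝔸 →L[ℂ] ℂ)))
      (((72 * ((d : ℝ) - 1) * ‖τ‖ * Lc ^ 3) * ((3 * d + 2) * d : ℕ)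
          + 8 * (‖τ‖ * (248 / 3 * ε₀ + 40 / 3 * ε)) * Lc ^ 4 * (4 * (4 * d : ℕ))) * Real.exp (δ' * 2))
      (ε / 2) := by
  have h := prop4Hyp_pinned_ord₃_eta_levels_dich_out_torusPin Λ Pl τ h₀ bd wt wd Dv Wf Wd W incl hη htr hincr hLc le_rfl
    (fun c => Or.inl (hst c)) hbd hor hWd0 hWf hcf hcd hDv hε hε₀ hε4 hηW hWw hwW hreg hd1 B₀ hB₀ hδ'
  have e : ((d : ℝ) - 1) * ‖τ‖ * (72 * Lc ^ 3 + 48 * 0 * Lc ^ 2 * ((3 * d + 2) * d : ℕ)) =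
      72 * ((d : ℝ) - 1) * ‖τ‖ * Lc ^ 3 := by ring
  rw [e] at h
  exact h

end Summit.QuantumFields.BalabanUV.T4Continuum.ShellMeasurePlaquetteCubicLocatedDichOut

end
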